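import Mathlib
import Summits.NavierStokesRegularity.NavierStokesRegularity.Theorems.TaoLadderRungTwoBreakOneShiftWindowPairStepD
import HarnessLib

/-!
# The one-shift window system, XXXV: THE REAL DATA OF A PAIR STEP — the `StepSlopeData` (part XVI) of a
# `PairStepD` whose `check` passed, read from the dyadic data, and the a-priori growth bound `|S_u − S_v| ≤ Wb |a − b|`
# of two runs of the same rough realisation (part XV `abs_pairGrowth_le` over the sparse rough Jacobian rows)
# (cell harvest/h2-tao-ladder, seat p2; rung1/KERNEL-CHEAP-REPLAY-SPEC.md §2 (d)/(e), §6 (iii)/(iv); support for K1(1)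
# = `NoSurvivingDSSOne`, stmt-NavierStokesRegularity-20205)

MODEL lattice ODEs only (Tao 2016 §4 normal form on Tao's shift set `S`); nothing here is a statement about
the Navier–Stokes equations; no item is closed; no instance is evaluated here. Generic in `ι`, `κ`.

* `cDg`, `cR`, `cBt`, `cL`, `cProx`, `cWb`, `cE`, `cZh`, `cζ` — the real fields read from the data through `e`;
* `exists_slopeData` — `check = true` ⇒ a `StepSlopeData ι` with exactly these fields (non-negativity, `E ≥ ∫e^{dg}`,
  the K–Z matrix fixed point and the contraction direction discharged from the Booleans via parts XXXII/XXXIII);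
* `abs_pair_le_Wb` — `check = true` ⇒ `|S_u(t) − S_v(t)|_j ≤ Σ_l Wb_jl |a_l − b_l|` on `[0, h)` for runs in the hull.
-/

-- the sub-problem namespace repeats the summit name by design (D-0017)
set_option linter.dupNamespace false

namespace Summit.NavierStokesRegularity.NavierStokesRegularity.Theorems

namespace DSSOneShift

open Set Finset Metric Filter Topology TopologicalSpace
open Literature.Analysis.ODE
open Summit.NavierStokesRegularity.NavierStokesRegularity.Theorems.TaylorModelCert
open Summit.NavierStokesRegularity.NavierStokesRegularity.Theorems.TaylorModelReadout
open Summit.NavierStokesRegularity.NavierStokesRegularity.Theorems.CertificateGlueOn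

namespace PairStepD

variable (d : PairStepD) {ι : Type*} [Fintype ι] [DecidableEq ι] {κ : Type*} [Fintype κ] (e : ι ≃ Fin d.n)

/-! ### The real fields -/

/-- Centre diagonal bound. [folklore] -/
noncomputable def cDg (i : ι) : ℝ := (d.toRoughStepD.dgD (e i)).toReal
/-- Centre off-diagonal magnitudes (sparse row read-out). [folklore] -/
noncomputable def cR (i j : ι) : ℝ := colVal (d.RcRow (e i)) (e j)
/-- `Bt`. [folklore] -/
noncomputable def cBt (i j : ι) : ℝ := Btf (d.row (e i)) (e j)
/-- `L`. [folklore] -/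
noncomputable def cL (i j k : ι) : ℝ := Lf (d.row (e i)) (e j) (e k)
/-- `prox`. [folklore] -/
noncomputable def cProx (k : ι) : ℝ := (d.proxD (e k)).toReal
/-- `Wb = I + Zg`. [folklore] -/
noncomputable def cWb (i l : ι) : ℝ := (d.Wb (e i) (e l)).toReal
/-- Centre weight `E`. [folklore] -/
noncomputable def cE (i : ι) : ℝ := (d.toRoughStepD.ED (e i)).toReal
/-- `Ẑ₂`. [folklore] -/
noncomputable def cZh (i l : ι) : ℝ := (d.mget d.Zh2 (e i) (e l)).toReal
/-- `ζ`. [folklore] -/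
noncomputable def cζ (i : ι) : ℝ := (RoughStepD.dget d.zeta (e i)).toReal

omit [Fintype ι] in
/-- The data rows are matched. [folklore] -/
theorem rowOK {Tc Tt : κ → BTerm ι} {rows : ι → List κ} (h : IsRTEncl e Tc Tt rows d.RD) (i : ι) :
    List.Forall₂ (fun dd k => TermOK e dd (Tc k) (Tt k)) (d.row (e i)) (rows i) := h.2.2 i

omit [Fintype ι] [DecidableEq ι] in
/-- The indicator column reads `colVal`. [folklore] -/
theorem mem_colVal_rowDot (row : List (ℕ × Dyad)) (l : ℕ) :
    IntervalD.mem (colVal row l) (d.rowDot row fun c => if c = l then Dyad.ofInt 1 else Dyad.ofInt 0) := by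
  have h := d.mem_rowDot (fun c => if c = l then Dyad.ofInt 1 else Dyad.ofInt 0) row
  have e : (row.map fun p => p.2.toReal * (if p.1 = l then Dyad.ofInt 1 else Dyad.ofInt 0).toReal).sum = colVal row l := by
    unfold colVal
    congr 1
    refine List.map_congr_left fun p _ => ?_
    split_ifs <;> simp
  rwa [e] at h

/-- **The `StepSlopeData` of a pair step that passed its test.** [cite: KapelaZgliczynski2009, §4 Lemma 4.1; cell vocabulary, harvest/h2-tao-ladder rung1/KERNEL-CHEAP-REPLAY-SPEC.md §6 (iii)] -/
theorem exists_slopeData {Tc : κ → BTerm ι} {rows : ι → List κ} (hRDc : IsRTEncl e Tc Tc rows d.RD) (hc : d.check = true) :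
    ∃ D : StepSlopeData ι, D.h = d.hD.toReal ∧ D.dg = d.cDg e ∧ D.R = d.cR e ∧ D.Bt = d.cBt e ∧ D.L = d.cL e ∧
      D.prox = d.cProx e ∧ D.Wb = d.cWb e ∧ D.E = d.cE e ∧ D.Zh = d.cZh e ∧ D.ζ = d.cζ e := by
  classical
  have hc' : d.toRoughStepD.check = true ∧ d.checkPair = true := by simpa [check, Bool.and_eq_true] using hc
  obtain ⟨hrc, hpc⟩ := hc'
  have hrc' : d.toRoughStepD.centre.check = true ∧ d.toRoughStepD.checkKZ = true := by
    simpa [RoughStepD.check, Bool.and_eq_true] using hrc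
  obtain ⟨hcc, hkz⟩ := hrc'
  obtain ⟨-, hK⟩ := d.toRoughStepD.of_checkKZ hkz
  have hcw := d.toRoughStepD.centre.of_checkWith (by rw [← CentreStepD.check_eq]; exact hcc)
  have hh : 0 ≤ d.hD.toReal := hcw.2.1
  have hP := d.of_checkPair hpc
  have hrow : ∀ i, List.Forall₂ (fun dd k => TermOK e dd (Tc k) (Tc k)) (d.row (e i)) (rows i) := d.rowOK e hRDc
  have hvRc : ∀ i, ∀ p ∈ d.RcRow (e i), p.1 < d.n := fun i =>
    fst_lt_of_mem_filter (fst_lt_of_mem_magRow e d.prec (RFac.cval d.Hs) (hrow i)) _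
  have hvAd : ∀ i, ∀ p ∈ d.AdRow (e i), p.1 < d.n := fun i => fst_lt_of_mem_adRow e d.proxD (hrow i)
  -- sparse products
  have hsumRc : ∀ i (g : ℕ → Dyad), IntervalD.mem (∑ j, d.cR e i j * (g (e j)).toReal) (d.rowDot (d.RcRow (e i)) g) := by
    intro i g
    have hs := sum_colVal_mul e (fun c => (g c).toReal) (hvRc i)
    unfold cR
    rw [hs]
    exact d.mem_rowDot g (d.RcRow (e i))
  have hsumAd : ∀ i l, IntervalD.mem (∑ j, (d.cBt e i j + ∑ k, d.cL e i j k * d.cProx e k) * d.cWb e j l)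
      (d.rowDot (d.AdRow (e i)) fun c => d.Wb c (e l)) := by
    intro i l
    have e1 : ∀ j, d.cBt e i j + ∑ k, d.cL e i j k * d.cProx e k = colVal (d.AdRow (e i)) (e j) := fun j =>
      Bt_add_L_prox_eq_colVal_adRow e d.proxD j (hrow i)
    simp_rw [e1]
    have hs := sum_colVal_mul e (fun c => (d.Wb c (e l)).toReal) (hvAd i)
    unfold cWb
    rw [hs]
    exact d.mem_rowDot (fun c => d.Wb c (e l)) (d.AdRow (e i))
  refine ⟨{
      h := d.hD.toReal, dg := d.cDg e, R := d.cR e, Bt := d.cBt e, L := d.cL e, prox := d.cProx e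
      Wb := d.cWb e, E := d.cE e, Zh := d.cZh e, ζ := d.cζ e
      h_nonneg := hh
      R_nonneg := fun i j => colVal_filter_nonneg (snd_nonneg_of_mem_magRow d.prec _ _) _ _
      Bt_nonneg := fun i j => (Btf_Lf_nonneg e (e j : ℕ) 0 (hrow i)).1
      L_nonneg := fun i j k => (Btf_Lf_nonneg e (e j : ℕ) (e k : ℕ) (hrow i)).2
      prox_nonneg := fun k => (hP (e k) (e k).isLt).2.2.1
      Wb_nonneg := fun i l => ?_
      Zh_nonneg := fun i l => ((hP (e i) (e i).isLt).2.2.2.2.2 (e l) (e l).isLt).2.1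
      ζ_pos := fun i => (hK (e i) (e i).isLt).2.1
      E_ge := fun i => ?_
      fix := fun i l => ?_
      dir := fun i => ?_ }, rfl, rfl, rfl, rfl, rfl, rfl, rfl, rfl, rfl, rfl⟩
  · -- Wb ≥ 0
    have hz := ((hP (e i) (e i).isLt).2.2.2.2.2 (e l) (e l).isLt).1
    unfold cWb PairStepD.Wb
    rw [Dyad.toReal_add]
    split_ifs <;> simp <;> linarith
  · -- E ≥ ∫ e^{dg}
    have hx := (hK (e i) (e i).isLt).2.2.1
    simp only [RoughStepD.xplus, Dyad.toReal_max, Dyad.toReal_mul, Dyad.toReal_ofInt, Int.cast_zero, max_le_iff] at hx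
    refine (gronwallBound_le_lin hh hx.1).trans (le_of_eq ?_)
    simp only [cE, RoughStepD.ED, RoughStepD.xplus, Dyad.toReal_mul, Dyad.toReal_add, Dyad.toReal_max, Dyad.toReal_ofInt]
    push_cast; ring
  · -- fix
    have hok := ((hP (e i) (e i).isLt).2.2.2.2.2 (e l) (e l).isLt).2.2.2
    unfold pairOK at hok
    refine IntervalD.le_of_hiLe hok ?_
    exact IntervalD.mem_mulR d.prec (IntervalD.mem_addR d.prec (hsumRc i fun c => d.mget d.Zh2 c (e l)) (hsumAd i l))
      (IntervalD.mem_ofDyad _)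
  · -- dir
    have hok := (hP (e i) (e i).isLt).2.2.2.2.1
    exact IntervalD.le_of_hiLe hok (IntervalD.mem_mulR d.prec (hsumRc i (RoughStepD.dget d.zeta)) (IntervalD.mem_ofDyad _))

/-- **THE A-PRIORI GROWTH OF A ROUGH PAIR DIFFERENCE** from the data: if the pair test passed and `S_u`, `S_v` are
runs of the same rough realisation staying in the hull `Hs` on `[0, h)`, then `|S_u(t) − S_v(t)|_j ≤ Σ_l Wb_jl |a_l − b_l|`
(part XV over the sparse rough Jacobian rows). [cite: KapelaZgliczynski2009, §4 Lemma 8 / Thm. 9; cell vocabulary, harvest/h2-tao-ladder rung1/KERNEL-CHEAP-REPLAY-SPEC.md §2 (d) (VU′)] -/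
theorem abs_pair_le_Wb {Tc : κ → BTerm ι} {Tf : ℝ → κ → BTerm ι} {rows : ι → List κ}
    (hRDc : IsRTEncl e Tc Tc rows d.RD) (hRD : ∀ t ∈ Ico 0 d.hD.toReal, IsRTEncl e Tc (Tf t) rows d.RD)
    (hc : d.check = true) (hmemH : ∀ x ∈ boxSet (boxOf e d.Hs), ∀ i, IntervalD.mem (x i) (IntervalD.aget d.Hs (e i)))
    {a b : ι → ℝ} {Su Sv : ℝ → ι → ℝ} (hSu0 : Su 0 = a) (hSv0 : Sv 0 = b)
    (hSu : ∀ t ∈ Icc 0 d.hD.toReal, HasDerivWithinAt Su (termField (Tf t) (Su t)) (Icc 0 d.hD.toReal) t)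
    (hSv : ∀ t ∈ Icc 0 d.hD.toReal, HasDerivWithinAt Sv (termField (Tf t) (Sv t)) (Icc 0 d.hD.toReal) t)
    (hmem : ∀ t ∈ Ico 0 d.hD.toReal, Su t ∈ boxSet (boxOf e d.Hs) ∧ Sv t ∈ boxSet (boxOf e d.Hs)) :
    ∀ t ∈ Ico 0 d.hD.toReal, ∀ j, |Su t j - Sv t j| ≤ ∑ l, d.cWb e j l * |a l - b l| := by
  classical
  have hc' : d.toRoughStepD.check = true ∧ d.checkPair = true := by simpa [check, Bool.and_eq_true] using hc
  obtain ⟨hrc, hpc⟩ := hc'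
  have hrc' : d.toRoughStepD.centre.check = true ∧ d.toRoughStepD.checkKZ = true := by
    simpa [RoughStepD.check, Bool.and_eq_true] using hrc
  have hcw := d.toRoughStepD.centre.of_checkWith (by rw [← CentreStepD.check_eq]; exact hrc'.1)
  have hh : 0 ≤ d.hD.toReal := hcw.2.1
  have hP := d.of_checkPair hpc
  have hrow : ∀ i, List.Forall₂ (fun dd k => TermOK e dd (Tc k) (Tc k)) (d.row (e i)) (rows i) := d.rowOK e hRDc
  have hvAb : ∀ i, ∀ p ∈ d.AbRow (e i), p.1 < d.n := fun i => fst_lt_of_mem_magRow e d.prec (RFac.rval d.Hs) (hrow i)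
  have hvRr : ∀ i, ∀ p ∈ d.RrRow (e i), p.1 < d.n := fun i => fst_lt_of_mem_filter (hvAb i) _
  intro t ht j
  -- rough data
  let dgr : ι → ℝ := fun i => (d.dgR (e i)).toReal
  let Rr : ι → ι → ℝ := fun i j => colVal (d.RrRow (e i)) (e j)
  let Ab : ι → ι → ℝ := fun i j => colVal (d.AbRow (e i)) (e j)
  let Zg : ι → ι → ℝ := fun i l => (d.mget d.Zg (e i) (e l)).toReal
  let Er : ι → ℝ := fun i => (d.ER (e i)).toReal
  let ζr : ι → ℝ := fun i => (RoughStepD.dget d.zetaR (e i)).toReal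
  have hstruct : ∀ s ∈ Ico 0 d.hD.toReal, ∃ A : Matrix ι ι ℝ,
      (fun s => termField (Tf s) (Su s) - termField (Tf s) (Sv s)) s = A.mulVec ((fun s => Su s - Sv s) s) ∧
      (∀ i, A i i ≤ dgr i) ∧ (∀ i j, i ≠ j → |A i j| ≤ Rr i j) ∧ (∀ i j, |A i j| ≤ Ab i j) := by
    intro s hs
    obtain ⟨hSuH, hSvH⟩ := hmem s hs
    obtain ⟨z, hz, hrep⟩ := exists_slopeMatrix_rows_on_segment (convex_boxSet (boxOf e d.Hs))
      (fun x _ => hasFDerivWithinAt_termField (Tf s) (boxSet (boxOf e d.Hs)) x) hSuH hSvH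
    have hzH : ∀ i, z i ∈ boxSet (boxOf e d.Hs) := fun i => (convex_boxSet _).segment_subset hSuH hSvH (hz i)
    refine ⟨Matrix.of fun i j => (termFieldDeriv (Tf s) (z i)) (Pi.single j 1) i, hrep, fun i => ?_, fun i j hij => ?_,
      fun i j => ?_⟩
    · simp only [Matrix.of_apply, termFieldDeriv_single]
      exact (mem_jacEntry_jacRowR e (hRD s hs) d.prec (hmemH _ (hzH i)) i i).2
    · simp only [Matrix.of_apply, termFieldDeriv_single]
      show |jacEntry (Tf s) (z i) i j| ≤ colVal (d.RrRow (e i)) (e j)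
      rw [PairStepD.RrRow, colVal_filter_ne (fun h' => hij (e.injective (Fin.ext h')).symm)]
      exact abs_jacEntry_le_colVal_rough e (hRD s hs) d.prec (hmemH _ (hzH i)) i j
    · simp only [Matrix.of_apply, termFieldDeriv_single]
      exact abs_jacEntry_le_colVal_rough e (hRD s hs) d.prec (hmemH _ (hzH i)) i j
  have hEr : ∀ i, gronwallBound 0 (dgr i) 1 d.hD.toReal ≤ Er i := by
    intro i
    have hx := (hP (e i) (e i).isLt).2.1
    simp only [PairStepD.xplusR, Dyad.toReal_max, Dyad.toReal_mul, Dyad.toReal_ofInt, Int.cast_zero, max_le_iff] at hx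
    refine (gronwallBound_le_lin hh hx.1).trans (le_of_eq ?_)
    simp only [Er, PairStepD.ER, PairStepD.xplusR, Dyad.toReal_mul, Dyad.toReal_add, Dyad.toReal_max, Dyad.toReal_ofInt]
    push_cast; ring
  have hfix : ∀ i l, ((∑ j, Rr i j * Zg j l) + Ab i l) * Er i ≤ Zg i l := by
    intro i l
    have hok := ((hP (e i) (e i).isLt).2.2.2.2.2 (e l) (e l).isLt).2.2.1
    unfold growthOK at hok
    refine IntervalD.le_of_hiLe hok (IntervalD.mem_mulR d.prec (IntervalD.mem_addR d.prec ?_ ?_) (IntervalD.mem_ofDyad _))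
    · have hs := sum_colVal_mul e (fun c => (d.mget d.Zg c (e l)).toReal) (hvRr i)
      show IntervalD.mem (∑ j, colVal (d.RrRow (e i)) (e j) * (d.mget d.Zg (e j) (e l)).toReal) _
      rw [hs]
      exact d.mem_rowDot (fun c => d.mget d.Zg c (e l)) (d.RrRow (e i))
    · exact d.mem_colVal_rowDot (d.AbRow (e i)) (e l)
  have hdir : ∀ i, (∑ j, Rr i j * ζr j) * Er i ≤ ζr i := by
    intro i
    have hok := (hP (e i) (e i).isLt).2.2.2.1
    refine IntervalD.le_of_hiLe hok (IntervalD.mem_mulR d.prec ?_ (IntervalD.mem_ofDyad _))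
    have hs := sum_colVal_mul e (fun c => (RoughStepD.dget d.zetaR c).toReal) (hvRr i)
    show IntervalD.mem (∑ j, colVal (d.RrRow (e i)) (e j) * (RoughStepD.dget d.zetaR (e j)).toReal) _
    rw [hs]
    exact d.mem_rowDot (RoughStepD.dget d.zetaR) (d.RrRow (e i))
  have hres := abs_pairGrowth_le (ι := ι) (w := fun s => Su s - Sv s)
    (w' := fun s => termField (Tf s) (Su s) - termField (Tf s) (Sv s)) (h := d.hD.toReal) hh
    (fun s hs => (hSu s hs).sub (hSv s hs)) (d := a - b) (by simp [hSu0, hSv0])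
    (dg := dgr) (R := Rr) (Ab := Ab) (Zh := Zg) (E := Er) (ζ := ζr)
    (fun i j => colVal_filter_nonneg (snd_nonneg_of_mem_magRow d.prec _ _) _ _)
    (fun i j => colVal_magRow_nonneg d.prec _ _ _)
    (fun i l => ((hP (e i) (e i).isLt).2.2.2.2.2 (e l) (e l).isLt).1) hstruct hEr hfix
    (fun i => (hP (e i) (e i).isLt).1) hdir t (Ico_subset_Icc_self ht) j
  -- |w| ≤ |d| + Zg |d| = Wb |d|
  have e1 : ∑ l, d.cWb e j l * |a l - b l| = |a j - b j| + ∑ l, Zg j l * |a l - b l| := by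
    simp only [cWb, PairStepD.Wb, Dyad.toReal_add, add_mul, Finset.sum_add_distrib]
    congr 1
    rw [Finset.sum_eq_single j]
    · simp
    · intro l _ hl; rw [if_neg (fun h' => hl (e.injective (Fin.ext h')).symm)]; simp
    · simp
  rw [e1]
  have h2 : |(Su t j - Sv t j) - (a j - b j)| ≤ ∑ l, Zg j l * |a l - b l| := by simpa using hres
  have h3 := abs_sub_abs_le_abs_sub (Su t j - Sv t j) (a j - b j)
  linarith

end PairStepD

end DSSOneShift

end Summit.NavierStokesRegularity.NavierStokesRegularity.Theorems
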